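import Literature.Analysis.UnboundedOperators.StrongContRepresentation
import Mathlib.Analysis.SpecialFunctions.Exp
import HarnessLib

/-!
# Restricting a strongly continuous representation / C₀-semigroup to a closed invariant
  subspace (subspace semigroups; Engel–Nagel I.5.12, II.2.3)

Analysis/UnboundedOperators support file (one definition with body, everything proved, no named
facts). Engel–Nagel (2000), Ch. I §5.12 / Ch. II §2.3 ("subspace semigroups"): if `Y` is a closed
subspace of `E` invariant under every `T(t)`, the restrictions `T(t)|_Y` form a strongly
continuous semigroup on `Y` (with generator the part of `A` in `Y`). We record:

* `StrongContRepresentation.subRep π W hW` (**definition**): the restriction of `π` to a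
  submodule `W` with `π g W ⊆ W`, as a strongly continuous representation on `W`;
  `subRep_apply_coe`;
* for C₀-semigroups on normed spaces: `C0Semigroup.subRep_app_coe`, the operator-norm bound
  `norm_subRep_app_le` (`‖T(t)|_W‖ ≤ ‖T(t)‖`) and the transfer of growth bounds
  `norm_subRep_app_le_of_le`;
* the standard source of invariant closed subspaces: `mem_ker_one_sub_of_commute` — if an
  operator `P` commutes with `T(t)` then `ker(1 − P)` (the range of `P` when `P² = P`) is
  invariant; used with the Leray projection `ℙ̂` (`FourierLerayProjection.lean`) to put the
  similarity heat semigroup on the divergence-free subspace `L²_σ`.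

## References

* K.-J. Engel, R. Nagel, *One-Parameter Semigroups for Linear Evolution Equations* (2000),
  Ch. I 5.12 and Ch. II 2.3 (subspace semigroups). [EngelNagel2000]
-/

noncomputable section

open Filter Topology
open scoped NNReal

namespace Literature.Analysis.UnboundedOperators

namespace StrongContRepresentation

variable {𝕜 G V : Type*} [Ring 𝕜] [Monoid G] [TopologicalSpace G]
  [AddCommGroup V] [TopologicalSpace V] [IsTopologicalAddGroup V] [Module 𝕜 V]

/-- **Restriction to an invariant subspace** ("subspace semigroup"): for a submodule `W` with
`π g W ⊆ W` for all `g`, the representation `g ↦ π g|_W` on `W`. [cite: EngelNagel2000, Ch. I 5.12] -/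
def subRep (π : StrongContRepresentation 𝕜 G V) (W : Submodule 𝕜 V)
    (hW : ∀ g, ∀ w ∈ W, π g w ∈ W) : StrongContRepresentation 𝕜 G W where
  toMonoidHom :=
    { toFun := fun g => ((π g).comp W.subtypeL).codRestrict W fun w => hW g w w.2
      map_one' := by
        ext w
        simp
      map_mul' := fun g h => by
        ext w
        simp [map_mul] }
  strongly_continuous w :=
    (π.continuous_apply_apply (w : V)).subtype_mk fun g => hW g w w.2

/-- `(π.subRep W hW) g w = π g w` in `V`. [cite: EngelNagel2000, Ch. I 5.12] -/
@[simp]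
theorem subRep_apply_coe (π : StrongContRepresentation 𝕜 G V) (W : Submodule 𝕜 V)
    (hW : ∀ g, ∀ w ∈ W, π g w ∈ W) (g : G) (w : W) :
    ((π.subRep W hW g w : W) : V) = π g w := rfl

end StrongContRepresentation

namespace C0Semigroup

variable {𝕜 E : Type*} [RCLike 𝕜] [NormedAddCommGroup E] [NormedSpace 𝕜 E]

/-- `(T.subRep W hW)(t) w = T(t) w` in `E`. [cite: EngelNagel2000, Ch. II 2.3] -/
@[simp]
theorem subRep_app_coe (T : C0Semigroup 𝕜 E) (W : Submodule 𝕜 E)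
    (hW : ∀ g, ∀ w ∈ W, T g w ∈ W) (t : ℝ≥0) (w : W) :
    ((C0Semigroup.app (T.subRep W hW) t w : W) : E) = T.app t w := rfl

/-- **`‖T(t)|_W‖ ≤ ‖T(t)‖`.** [cite: EngelNagel2000, Ch. II 2.3] -/
theorem norm_subRep_app_le (T : C0Semigroup 𝕜 E) (W : Submodule 𝕜 E)
    (hW : ∀ g, ∀ w ∈ W, T g w ∈ W) (t : ℝ≥0) :
    ‖C0Semigroup.app (T.subRep W hW) t‖ ≤ ‖T.app t‖ := by
  refine ContinuousLinearMap.opNorm_le_bound _ (norm_nonneg _) fun w => ?_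
  rw [Submodule.coe_norm, subRep_app_coe]
  exact ((T.app t).le_opNorm _).trans (le_of_eq (by rw [Submodule.coe_norm]))

/-- Growth bounds transfer to the subspace semigroup. [cite: EngelNagel2000, Ch. II 2.3] -/
theorem norm_subRep_app_le_of_le (T : C0Semigroup 𝕜 E) (W : Submodule 𝕜 E)
    (hW : ∀ g, ∀ w ∈ W, T g w ∈ W) {M ω : ℝ} (hM : ∀ t : ℝ≥0, ‖T.app t‖ ≤ M * Real.exp (ω * t))
    (t : ℝ≥0) : ‖C0Semigroup.app (T.subRep W hW) t‖ ≤ M * Real.exp (ω * t) :=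
  (norm_subRep_app_le T W hW t).trans (hM t)

/-- **Invariant subspaces from commuting operators**: if `P` commutes with `S` then
`ker(1 − P)` (`= Ran P` when `P² = P`) is invariant under `S`. [folklore] -/
theorem mem_ker_one_sub_of_commute {P S : E →L[𝕜] E} (h : Commute P S) {v : E}
    (hv : v ∈ LinearMap.ker ((1 - P : E →L[𝕜] E) : E →ₗ[𝕜] E)) :
    S v ∈ LinearMap.ker ((1 - P : E →L[𝕜] E) : E →ₗ[𝕜] E) := by
  rw [LinearMap.mem_ker] at hv ⊢
  have hPv : P v = v := by
    have : (1 - P) v = 0 := hv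
    rwa [sub_apply, one_apply_eq_self, sub_eq_zero, eq_comm] at this
  show (1 - P) (S v) = 0
  rw [sub_apply, one_apply_eq_self, sub_eq_zero, ← mul_apply_eq_comp, h.eq,
    mul_apply_eq_comp, hPv]

/-- The invariance hypothesis of `subRep` for `W = ker(1 − P)` from commutation of `P` with every
`T(t)`. [folklore] -/
theorem subRep_hyp_of_commute (T : C0Semigroup 𝕜 E) {P : E →L[𝕜] E}
    (h : ∀ t : ℝ≥0, Commute P (T.app t)) :
    ∀ g : Multiplicative ℝ≥0, ∀ w ∈ LinearMap.ker ((1 - P : E →L[𝕜] E) : E →ₗ[𝕜] E),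
      T g w ∈ LinearMap.ker ((1 - P : E →L[𝕜] E) : E →ₗ[𝕜] E) :=
  fun g _ hw => mem_ker_one_sub_of_commute (h (Multiplicative.toAdd g)) hw

end C0Semigroup

end Literature.Analysis.UnboundedOperators
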